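import Mathlib.Analysis.Fourier.Convolution
import Mathlib.Analysis.Fourier.Inversion
import Mathlib.MeasureTheory.Function.L2Space
import Literature.Analysis.FunctionSpaces.PlancherelL1L2
import HarnessLib

/-!
# Fourier toolkit for the fractal uncertainty principle: `𝓕⁻` on `L¹ ∩ L²(ℝ)`

Topic `Literature/Analysis/Fourier`. Small, fully proved lemmas used by the iteration argument
of J. Bourgain, S. Dyatlov, *Spectral gaps without the pressure condition*, Ann. of Math. 187
(2018), §3.4 (proof of Theorem 4, `bourgainDyatlov2018_thm4`), written in the "`g`-language" of
`FractalUncertaintyPrinciple.lean`: a function `f` with `supp f̂ ⊂ Y` is presented as `f = 𝓕⁻ g`,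
`g ∈ L¹ ∩ L²`, `g = 0` off `Y`.

* `integral_norm_sq_fourierInv_eq` — Plancherel `∫ ‖𝓕⁻ g‖² = ∫ ‖g‖²` on `L¹ ∩ L²(ℝ)` (from the
  tree's `Literature.Analysis.FunctionSpaces.integral_norm_sq_fourierIntegral_eq`);
* `fourierInv_convolution_eq` — `𝓕⁻(u ⋆ g) = 𝓕⁻ u · 𝓕⁻ g` (Mathlib's convolution theorem);
* `convolution_eq_zero_of_notMem_add` — `u ⋆ g = 0` off `A + B` if `u = 0` off `A`, `g = 0` off `B`;
* `norm_convolution_le`, `integrable_and_memLp_two_convolution` — `‖u ⋆ g‖_∞ ≤ ‖u‖_∞ ‖g‖₁`,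
  and `u ⋆ g ∈ L¹ ∩ L²` for bounded, boundedly supported `u` and boundedly supported `g ∈ L¹`;
* `integral_norm_sq_rescale_eq`, `fourierInv_rescale_eq`, `setIntegral_norm_sq_fourierInv_rescale_eq`,
  `integrable_rescale`, `memLp_two_rescale` — the unitary rescaling `g̃(η) = √c · g(cη)`,
  `𝓕⁻ g̃ (x) = (√c)⁻¹ 𝓕⁻ g (x/c)` (BD18 §3.4, proof of Lemma 3.5: `f̃(x) = L^{-n/2} f(L^{-n}x)`).

All statements are folklore; no new definitions.
-/

namespace Literature.Analysis.Fourier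

open _root_.MeasureTheory Set Function
open scoped FourierTransform ENNReal Convolution Pointwise

section Plancherel

/-- **Plancherel for `𝓕⁻` on `L¹ ∩ L²(ℝ)`**: `∫ ‖𝓕⁻ g‖² = ∫ ‖g‖²` (from the `𝓕` version in
`Literature.Analysis.FunctionSpaces` and `𝓕⁻ g = 𝓕 (g ∘ neg)`). [folklore] -/
theorem integral_norm_sq_fourierInv_eq {g : ℝ → ℂ} (h1 : Integrable g) (h2 : MemLp g 2 volume) :
    ∫ x, ‖(𝓕⁻ g : ℝ → ℂ) x‖ ^ 2 = ∫ ξ, ‖g ξ‖ ^ 2 := by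
  rw [Real.fourierInv_eq_fourier_comp_neg]
  have h1' : Integrable (fun x => g (-x)) := h1.comp_neg
  have h2' : MemLp (fun x => g (-x)) 2 volume :=
    h2.comp_measurePreserving (Measure.measurePreserving_neg volume)
  rw [Literature.Analysis.FunctionSpaces.integral_norm_sq_fourierIntegral_eq h1' h2']
  exact integral_neg_eq_self (fun x => ‖g x‖ ^ 2) volume

/-- `𝓕⁻ g` is in `L²` with `∫ ‖𝓕⁻ g‖²` finite: integrability of `‖𝓕⁻ g‖²` for `g ∈ L¹ ∩ L²`.
[folklore] -/
theorem integrable_norm_sq_fourierInv {g : ℝ → ℂ} (h1 : Integrable g) (h2 : MemLp g 2 volume) :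
    Integrable (fun x => ‖(𝓕⁻ g : ℝ → ℂ) x‖ ^ 2) := by
  rw [Real.fourierInv_eq_fourier_comp_neg]
  have h1' : Integrable (fun x => g (-x)) := h1.comp_neg
  have h2' : MemLp (fun x => g (-x)) 2 volume :=
    h2.comp_measurePreserving (Measure.measurePreserving_neg volume)
  have hF := Literature.Analysis.FunctionSpaces.memLp_two_fourierIntegral h1' h2'
  exact (memLp_two_iff_integrable_sq_norm hF.1).1 hF

end Plancherel

section ConvolutionTools

/-- **Convolution theorem for `𝓕⁻`**: `𝓕⁻ (u ⋆ g) = 𝓕⁻ u · 𝓕⁻ g` pointwise, for `u, g ∈ L¹(ℝ)`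
(Mathlib's `Real.fourier_mul_convolution_eq` at `-x`). [folklore] -/
theorem fourierInv_convolution_eq {u g : ℝ → ℂ} (hu : Integrable u) (hg : Integrable g) (x : ℝ) :
    (𝓕⁻ (u ⋆[ContinuousLinearMap.mul ℂ ℂ, volume] g) : ℝ → ℂ) x =
      (𝓕⁻ u : ℝ → ℂ) x * (𝓕⁻ g : ℝ → ℂ) x := by
  simp only [Real.fourierInv_eq_fourier_neg]
  exact Real.fourier_mul_convolution_eq hu hg (-x)

/-- Support of a convolution: if `u = 0` off `A` and `g = 0` off `B` then `u ⋆ g = 0` off `A + B`.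
[folklore] -/
theorem convolution_eq_zero_of_notMem_add {u g : ℝ → ℂ} {A B : Set ℝ}
    (hu : ∀ x, x ∉ A → u x = 0) (hg : ∀ x, x ∉ B → g x = 0) {ξ : ℝ} (hξ : ξ ∉ A + B) :
    (u ⋆[ContinuousLinearMap.mul ℂ ℂ, volume] g) ξ = 0 := by
  have hA : support u ⊆ A := fun x hx => by_contra fun h => hx (hu x h)
  have hB : support g ⊆ B := fun x hx => by_contra fun h => hx (hg x h)
  by_contra h
  exact hξ (Set.add_subset_add hA hB
    (support_convolution_subset (ContinuousLinearMap.mul ℂ ℂ) (mem_support.2 h)))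

/-- `‖(u ⋆ g)(ξ)‖ ≤ ‖u‖_∞ ‖g‖_{L¹}`. [folklore] -/
theorem norm_convolution_le {u g : ℝ → ℂ} {C : ℝ} (hC : ∀ x, ‖u x‖ ≤ C) (hg : Integrable g)
    (ξ : ℝ) : ‖(u ⋆[ContinuousLinearMap.mul ℂ ℂ, volume] g) ξ‖ ≤ C * ∫ x, ‖g x‖ := by
  have hC0 : 0 ≤ C := (norm_nonneg _).trans (hC 0)
  rw [convolution_def]
  have hint : Integrable (fun t => C * ‖g (ξ - t)‖) :=
    ((hg.comp_sub_left ξ).norm.const_mul C)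
  calc ‖∫ t, (ContinuousLinearMap.mul ℂ ℂ) (u t) (g (ξ - t))‖
      ≤ ∫ t, ‖(ContinuousLinearMap.mul ℂ ℂ) (u t) (g (ξ - t))‖ := norm_integral_le_integral_norm _
    _ ≤ ∫ t, C * ‖g (ξ - t)‖ := by
        apply integral_mono_of_nonneg (Filter.Eventually.of_forall fun _ => norm_nonneg _) hint
        refine Filter.Eventually.of_forall fun t => ?_
        simp only [ContinuousLinearMap.mul_apply', norm_mul]
        exact mul_le_mul_of_nonneg_right (hC t) (norm_nonneg _)
    _ = C * ∫ t, ‖g (ξ - t)‖ := integral_const_mul _ _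
    _ = C * ∫ x, ‖g x‖ := by rw [integral_sub_left_eq_self (fun x => ‖g x‖) volume ξ]

/-- A bounded measurable function vanishing off a bounded set is integrable. [folklore] -/
theorem integrable_of_bounded_of_vanish {u : ℝ → ℂ} {A : Set ℝ} {C : ℝ}
    (hum : AEStronglyMeasurable u volume) (hC : ∀ x, ‖u x‖ ≤ C) (hu0 : ∀ x, x ∉ A → u x = 0)
    (hA : Bornology.IsBounded A) : Integrable u := by
  have htop : MemLp u ∞ volume := memLp_top_of_bound hum C (Filter.Eventually.of_forall hC)
  have h1 : MemLp u 1 volume :=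
    htop.mono_exponent_of_measure_support_ne_top hu0 hA.measure_lt_top.ne le_top
  exact memLp_one_iff_integrable.1 h1

/-- If `u` is bounded, measurable and vanishes off a bounded set `A`, and `g ∈ L¹` vanishes off a
bounded set `B`, then `u ⋆ g ∈ L¹ ∩ L²(ℝ)` (it is bounded by `‖u‖_∞‖g‖₁` and vanishes off the
bounded set `A + B`). [folklore] -/
theorem integrable_and_memLp_two_convolution {u g : ℝ → ℂ} {A B : Set ℝ} {C : ℝ}
    (hum : AEStronglyMeasurable u volume) (hC : ∀ x, ‖u x‖ ≤ C) (hu0 : ∀ x, x ∉ A → u x = 0)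
    (hA : Bornology.IsBounded A) (hg : Integrable g) (hg0 : ∀ x, x ∉ B → g x = 0)
    (hB : Bornology.IsBounded B) :
    Integrable (u ⋆[ContinuousLinearMap.mul ℂ ℂ, volume] g) ∧
      MemLp (u ⋆[ContinuousLinearMap.mul ℂ ℂ, volume] g) 2 volume := by
  have hu : Integrable u := integrable_of_bounded_of_vanish hum hC hu0 hA
  have hint : Integrable (u ⋆[ContinuousLinearMap.mul ℂ ℂ, volume] g) :=
    hu.integrable_convolution _ hg
  refine ⟨hint, ?_⟩
  have htop : MemLp (u ⋆[ContinuousLinearMap.mul ℂ ℂ, volume] g) ∞ volume :=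
    memLp_top_of_bound hint.aestronglyMeasurable (C * ∫ x, ‖g x‖)
      (Filter.Eventually.of_forall (norm_convolution_le hC hg))
  exact htop.mono_exponent_of_measure_support_ne_top
    (fun ξ hξ => convolution_eq_zero_of_notMem_add hu0 hg0 hξ) (hA.add hB).measure_lt_top.ne le_top

end ConvolutionTools

section Rescaling

variable {g : ℝ → ℂ} {c : ℝ}

/-- `𝓕⁻ f (w) = ∫ 𝐞(v w) f(v) dv` on `ℝ`. [folklore] -/
theorem fourierInv_real_eq (f : ℝ → ℂ) (w : ℝ) :
    (𝓕⁻ f : ℝ → ℂ) w = ∫ v : ℝ, 𝐞 (v * w) • f v := by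
  rw [Real.fourierInv_eq_fourier_neg, Real.fourier_real_eq]
  simp

/-- The rescaling `g̃(η) = √c · g(cη)` (`c > 0`) preserves `∫ ‖·‖²`. [folklore] -/
theorem integral_norm_sq_rescale_eq (hc : 0 < c) :
    ∫ η, ‖(Real.sqrt c : ℂ) * g (c * η)‖ ^ 2 = ∫ ξ, ‖g ξ‖ ^ 2 := by
  have h1 : ∀ η, ‖(Real.sqrt c : ℂ) * g (c * η)‖ ^ 2 = c * ‖g (c * η)‖ ^ 2 := by
    intro η
    rw [norm_mul, mul_pow, Complex.norm_real, Real.norm_eq_abs, abs_of_nonneg (Real.sqrt_nonneg c),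
      Real.sq_sqrt hc.le]
  simp_rw [h1]
  rw [integral_const_mul, Measure.integral_comp_mul_left (fun ξ => ‖g ξ‖ ^ 2) c, smul_eq_mul,
    abs_of_pos (inv_pos.2 hc), ← mul_assoc, mul_inv_cancel₀ hc.ne', one_mul]

/-- `𝓕⁻ g̃ (x) = (√c)⁻¹ · 𝓕⁻ g (x / c)` for `g̃(η) = √c · g(cη)`, `c > 0`. [folklore] -/
theorem fourierInv_rescale_eq (hc : 0 < c) (x : ℝ) :
    (𝓕⁻ (fun η => (Real.sqrt c : ℂ) * g (c * η)) : ℝ → ℂ) x =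
      ((Real.sqrt c)⁻¹ : ℂ) * (𝓕⁻ g : ℝ → ℂ) (x / c) := by
  rw [fourierInv_real_eq, fourierInv_real_eq]
  have key : (fun v : ℝ => 𝐞 (v * x) • ((Real.sqrt c : ℂ) * g (c * v))) =
      fun v => (fun ξ : ℝ => 𝐞 (ξ * (x / c)) • ((Real.sqrt c : ℂ) * g ξ)) (c * v) := by
    funext v
    simp only
    congr 2
    field_simp
  rw [key, Measure.integral_comp_mul_left
    (fun ξ : ℝ => 𝐞 (ξ * (x / c)) • ((Real.sqrt c : ℂ) * g ξ)) c, abs_of_pos (inv_pos.2 hc)]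
  have h2 : (fun ξ : ℝ => 𝐞 (ξ * (x / c)) • ((Real.sqrt c : ℂ) * g ξ)) =
      fun ξ => (Real.sqrt c : ℂ) • (𝐞 (ξ * (x / c)) • g ξ) := by
    funext ξ
    simp only [Circle.smul_def, smul_eq_mul]
    ring
  rw [h2, integral_smul, Complex.real_smul, smul_eq_mul, ← mul_assoc]
  congr 1
  have hs : (Real.sqrt c : ℂ) ≠ 0 := by exact_mod_cast (Real.sqrt_pos.2 hc).ne'
  have hcc : (c : ℂ) = (Real.sqrt c : ℂ) * (Real.sqrt c : ℂ) := by
    exact_mod_cast (Real.mul_self_sqrt hc.le).symm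
  push_cast
  rw [hcc, mul_inv, mul_assoc, inv_mul_cancel₀ hs, mul_one]

/-- Set-integral form of the rescaling: `∫_U ‖𝓕⁻ g̃‖² = ∫_{c⁻¹U} ‖𝓕⁻ g‖²`. [folklore] -/
theorem setIntegral_norm_sq_fourierInv_rescale_eq (hc : 0 < c) (U : Set ℝ) :
    ∫ x in U, ‖(𝓕⁻ (fun η => (Real.sqrt c : ℂ) * g (c * η)) : ℝ → ℂ) x‖ ^ 2 =
      ∫ y in c⁻¹ • U, ‖(𝓕⁻ g : ℝ → ℂ) y‖ ^ 2 := by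
  simp_rw [fourierInv_rescale_eq hc]
  have h1 : ∀ x, ‖((Real.sqrt c)⁻¹ : ℂ) * (𝓕⁻ g : ℝ → ℂ) (x / c)‖ ^ 2 =
      c⁻¹ * ‖(𝓕⁻ g : ℝ → ℂ) (c⁻¹ • x)‖ ^ 2 := by
    intro x
    rw [norm_mul, mul_pow, norm_inv, Complex.norm_real, Real.norm_eq_abs,
      abs_of_nonneg (Real.sqrt_nonneg _), inv_pow, Real.sq_sqrt hc.le, smul_eq_mul,
      div_eq_inv_mul]
  simp_rw [h1]
  rw [integral_const_mul, Measure.setIntegral_comp_smul_of_pos volume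
    (fun y => ‖(𝓕⁻ g : ℝ → ℂ) y‖ ^ 2) U (inv_pos.2 hc)]
  simp only [Module.finrank_self, pow_one, inv_inv, smul_eq_mul, ← mul_assoc,
    inv_mul_cancel₀ hc.ne', one_mul]

/-- The rescaled function `g̃(η) = √c · g(cη)` is integrable if `g` is (`c ≠ 0`). [folklore] -/
theorem integrable_rescale (hg : Integrable g) (hc : c ≠ 0) :
    Integrable (fun η => (Real.sqrt c : ℂ) * g (c * η)) :=
  (hg.comp_mul_left' hc).const_mul _

/-- The rescaled function `g̃(η) = √c · g(cη)` is in `L²` if `g ∈ L¹ ∩ L²` (`c > 0`). [folklore] -/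
theorem memLp_two_rescale (hg : Integrable g) (hg2 : MemLp g 2 volume) (hc : 0 < c) :
    MemLp (fun η => (Real.sqrt c : ℂ) * g (c * η)) 2 volume := by
  rw [memLp_two_iff_integrable_sq_norm (integrable_rescale hg hc.ne').aestronglyMeasurable]
  have h1 : ∀ η, ‖(Real.sqrt c : ℂ) * g (c * η)‖ ^ 2 = c * ‖g (c * η)‖ ^ 2 := by
    intro η
    rw [norm_mul, mul_pow, Complex.norm_real, Real.norm_eq_abs, abs_of_nonneg (Real.sqrt_nonneg c),
      Real.sq_sqrt hc.le]
  simp_rw [h1]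
  have h2 : Integrable (fun ξ => ‖g ξ‖ ^ 2) := (memLp_two_iff_integrable_sq_norm hg2.1).1 hg2
  exact (h2.comp_mul_left' hc.ne').const_mul c

/-- The rescaled function vanishes off `c⁻¹ • B` if `g` vanishes off `B` (`c ≠ 0`). [folklore] -/
theorem rescale_eq_zero {B : Set ℝ} (hg0 : ∀ x, x ∉ B → g x = 0) (hc : c ≠ 0) {η : ℝ}
    (hη : η ∉ c⁻¹ • B) : (Real.sqrt c : ℂ) * g (c * η) = 0 := by
  have : c * η ∉ B := by
    intro h
    apply hη
    rw [Set.mem_smul_set_iff_inv_smul_mem₀ (inv_ne_zero hc), inv_inv, smul_eq_mul]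
    exact h
  rw [hg0 _ this, mul_zero]

end Rescaling

end Literature.Analysis.Fourier
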